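import Mathlib
import Summits.Ventures.PercRepro2.SwOutShadowMultiRootCanonical
import Summits.Ventures.PercRepro2.SwAllMarkStepDeco

/-!
# THE MARK STEP WITH ANY SET OF JUNCTIONS UNDER THE LOCAL CONDITIONS (blind cell PercRepro2,
night-4 g36, 2026-08-29; proofs/NIGHT4-G35.md §8 (a))

g35's `swAll_markStep_of_junctions_deco` asks the seven canonical conditions of the decorated
cubes at every side point of every pattern; SwOutShadowMultiRootCanonical proves the clustered and
the stray-free ones from the side point (`clustered_of_side`, `noStray_of_side`) and the units
inside `{l}ᶜ` is automatic (`l_notMem_of_mem_unitsR`).  Hence the mark step holds under the three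
LOCAL conditions `DecoCanonicalLoc` (pure, disjoint, attached units; every escaping junction
routed) alone: **`gTypedSwAll_of_junctions_loc`**, **`swAll_markStep_of_junctions_loc`**,
`sw_markStep_of_junctions_loc` — the hypotheses the census verifies (mining/night-4/g35, design 14).
-/

namespace Summit.Ventures.PercRepro2

namespace LocRows

open Hull

variable {V : Type*} {E : Type*}

open scoped Classical

variable {ends : E → Sym2 V}

section Graph

variable [Fintype E] [DecidableEq E] {ξ : Config E} {l h : V}
  {𝓤 𝓓 𝓓'' : Set (Set V)} {X : Set V} {𝓤' : Set (Set V)} {F : V → Prop}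

/-- **The multi-junction class from the decorated cubes on the graph under the local
conditions**: the general doubly typed row on every graph with the junctions `J` in `{l}ᶜ`, under
pure, disjoint, attached units and routed escapes on every fibre of every class (the units lie
in `{l}ᶜ` automatically). -/
theorem gTypedSwAll_of_junctions_loc {J : Finset V} (hlh : l ≠ h)
    (hloop : ∀ e r, r ∈ insert h (↑J : Set V) → ends e ≠ s(r, r))
    (h𝓤 : IsUpperSet 𝓤) (h𝓓 : IsLowerSet 𝓓) (h𝓓'' : IsLowerSet 𝓓'') (h𝓤' : IsUpperSet 𝓤')
    (hF : ∀ x, F x → ∀ S ∈ 𝓤, x ∈ S) (hhX : h ∉ X) (hJX : ∀ u ∈ J, u ∉ X)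
    (hX : ∀ x ∈ X, x ≠ l → ∀ e, x ∈ ends e → ends e = s(x, x))
    (hout : ∀ x, x ≠ l → x ≠ h → x ∉ J →
      F x ∨ x ∈ X ∨ (∃ e, ends e = s(x, l)) ∨ (∀ e, x ∉ ends e))
    (hcan : ∀ ξ, ∀ T ⊆ J, ∀ ζ ∈ gOutSide ends l h 𝓤 𝓓 𝓓'' X 𝓤' ({l}ᶜ) ξ,
      escSetE ends J ({l}ᶜ) ζ = T →
        DecoCanonicalLoc ends (insert h (↑(J \ T) : Set V)) l (↑T) ζ) :
    GTypedSwAll ends l h 𝓤 𝓓 𝓓'' X 𝓤' := by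
  refine gTypedSwAll_of_junctions_deco (F := F) (J := J) hlh hloop h𝓤 h𝓓 h𝓓'' h𝓤' hF hhX hJX hX
    hout ?_
  intro ξ T hT ζ hζ hesc
  have hl : l ∉ ({l}ᶜ : Set V) := by simp
  have hout' : ∀ x ∈ ({l}ᶜ : Set V), x ≠ h → x ∉ J →
      F x ∨ x ∈ X ∨ (∃ e y, ends e = s(x, y) ∧ y ∉ ({l}ᶜ : Set V)) ∨ (∀ e, x ∉ ends e) := by
    intro x hx hxh hxJ
    rcases hout x (by simpa using hx) hxh hxJ with hf | hxX | ⟨e, he⟩ | hiso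
    · exact Or.inl hf
    · exact Or.inr (Or.inl hxX)
    · exact Or.inr (Or.inr (Or.inl ⟨e, l, he, by simp⟩))
    · exact Or.inr (Or.inr (Or.inr hiso))
  have hX' : ∀ x ∈ X, x ∈ ({l}ᶜ : Set V) → ∀ e, x ∈ ends e → ends e = s(x, x) :=
    fun x hx hxU e hxe => hX x hx (by simpa using hxU) e hxe
  obtain ⟨hne, -⟩ := (mem_fibreE_iff hT hζ).1 hesc
  have hU : ∀ u ∈ unitsR ends (insert h (↑(J \ T) : Set V)) l ζ, u ⊆ ({l}ᶜ : Set V) := by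
    intro u hu x hx hxl
    rw [Set.mem_singleton_iff] at hxl
    subst hxl
    exact l_notMem_of_mem_unitsR hl hne hu hx
  exact decoCanonical_of_junctions hl hloop hF hout' hX' hT hζ hesc (hcan ξ T hT ζ hζ hesc) hU

end Graph

section MarkStep

variable [Fintype E] [DecidableEq E] {l h x : V}

/-- **THE GENERAL MARK STEP WITH ANY SET OF JUNCTIONS UNDER THE LOCAL CONDITIONS**: row 2′SW-ALL
with the mark `x` on every graph whose vertices other than `l, h, x` are joined to `l`, hang on
the mark, or belong to a set `J` of junctions (no loop at `h` or at a junction; `l, h, x ∉ J`),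
under pure, disjoint, attached units with routed escapes on every pattern of the mark's edges —
g35's `swAll_markStep_of_junctions_deco` with the clustered and stray-free conditions discharged. -/
theorem swAll_markStep_of_junctions_loc (hlh : l ≠ h) (hloop : ∀ e, ends e ≠ s(h, h))
    (hxl : x ≠ l) (hxh : x ≠ h) {J : Finset V} (hlJ : l ∉ J) (hhJ : h ∉ J) (hxJ : x ∉ J)
    (hloopJ : ∀ u ∈ J, ∀ e, ends e ≠ s(u, u))
    (hout : ∀ y, y ≠ l → y ≠ h → y ≠ x → y ∉ J →
      (∃ e, ends e = s(y, l)) ∨ (∀ e, y ∈ ends e → x ∈ ends e))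
    (hcan : ∀ d : Config E, ∀ ξ, ∀ T ⊆ J, ∀ ζ ∈ gOutSide (isolate ends x) l h (markU ends d x)
      (markD ends d x) (markD'' ends d x) {x} Set.univ ({l}ᶜ) ξ,
        escSetE (isolate ends x) J ({l}ᶜ) ζ = T →
          DecoCanonicalLoc (isolate ends x) (insert h (↑(J \ T) : Set V)) l (↑T) ζ) :
    SwAll ends l h x := by
  have _hlJ := hlJ
  have _hhJ := hhJ
  refine swAll_of_gTyped_patterns hxl hxh fun d _ => ?_
  have hloop' : ∀ e r, r ∈ insert h (↑J : Set V) → ends e ≠ s(r, r) := by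
    rintro e r (rfl | hr)
    · exact hloop e
    · exact hloopJ r hr e
  refine gTypedSwAll_of_junctions_loc
    (F := fun y => y ∈ openNbrs ends d x ∧ ∀ z ∈ openNbrs ends d x, z = y) (J := J)
    hlh (isolate_hloop_set hxh hxJ hloop') (isUpperSet_markU d x) (isLowerSet_markD d x)
    (isLowerSet_markD'' d x) isUpperSet_univ ?_ ?_ ?_ ?_ ?_ (hcan d)
  · -- the unique red neighbour is forced into `C_R(l)`
    rintro y ⟨-, huniq⟩ S ⟨z, hz, hzS⟩
    rw [← huniq z hz]
    exact hzS
  · exact fun h' => hxh (Set.mem_singleton_iff.1 h').symm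
  · intro u hu h'
    exact hxJ ((Set.mem_singleton_iff.1 h') ▸ hu)
  · intro y hy _ e hye
    rw [Set.mem_singleton_iff] at hy
    subst hy
    exact isolate_selfLoops e hye
  · intro y hyl hyh hyJ
    by_cases hyx : y = x
    · exact Or.inr (Or.inl (by rw [hyx]; exact Set.mem_singleton _))
    by_cases hyF : y ∈ openNbrs ends d x ∧ ∀ z ∈ openNbrs ends d x, z = y
    · exact Or.inl hyF
    rcases hout y hyl hyh hyx hyJ with ⟨e, he⟩ | hiso
    · exact Or.inr (Or.inr (Or.inl ⟨e, isolate_eq_of_ends_eq hyx hxl.symm he⟩))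
    · exact Or.inr (Or.inr (Or.inr (isolate_iso hyx hiso)))

/-- **Row (SW) from the general mark step with any set of junctions under the local
conditions.** -/
theorem sw_markStep_of_junctions_loc (hlh : l ≠ h) (hloop : ∀ e, ends e ≠ s(h, h))
    (hxl : x ≠ l) (hxh : x ≠ h) {J : Finset V} (hlJ : l ∉ J) (hhJ : h ∉ J) (hxJ : x ∉ J)
    (hloopJ : ∀ u ∈ J, ∀ e, ends e ≠ s(u, u))
    (hout : ∀ y, y ≠ l → y ≠ h → y ≠ x → y ∉ J →
      (∃ e, ends e = s(y, l)) ∨ (∀ e, y ∈ ends e → x ∈ ends e))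
    (hcan : ∀ d : Config E, ∀ ξ, ∀ T ⊆ J, ∀ ζ ∈ gOutSide (isolate ends x) l h (markU ends d x)
      (markD ends d x) (markD'' ends d x) {x} Set.univ ({l}ᶜ) ξ,
        escSetE (isolate ends x) J ({l}ᶜ) ζ = T →
          DecoCanonicalLoc (isolate ends x) (insert h (↑(J \ T) : Set V)) l (↑T) ζ) :
    Sw ends l h x :=
  sw_of_swAll ends
    (swAll_markStep_of_junctions_loc hlh hloop hxl hxh hlJ hhJ hxJ hloopJ hout hcan)

end MarkStep

end LocRows

end Summit.Ventures.PercRepro2
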